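import Summits.Ventures.MM22.Rank333.GF2ProfileSymmetrySub
import Summits.Ventures.MM22.Rank333.Wang333TopCerts
import HarnessLib

/-!
# MM22 venture — `⟨3,3,3⟩/𝔽₂`: the 255 planes through form `84` as certified rows, and «no valid 19-profile on `S_[84]` ⇒ `Cert [84] 20`»

HONEST FRAMING (cell `pub-mm22`, seat LIT-2 g9; v4 item (0′), the `494 @ 20` object). PLUMBING over Wang's printed
table, no new bound. The last non-kernel antecedent of the cell's root implication (`rankGe21F2_of_lifts8`, lead
2026-08-23T01:06:41Z) is the lift `494 @ 20` = `Cert 3 3 3 [84] 20`, which p2's PROFILE-CERT (3,731 nodes on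
`487/488/490/491 @ 19`) proves as «no valid 19-profile on `S_[84]`». This file turns the tree's sub-instance glue
(`GF2ProfileRowsSub.lean`) into the exact target for that certificate's kernel checker:

* `planeRowB` / `planeRows_ok` / `cert_of_mem_tab494` / `cert_plane84` — **every plane `{84, f}` (`f` one of the 255
  candidate forms `c494` of Wang's orbit `[84]`, index 494) is a certified row `Cert 3 3 3 [84, f] 18`**: Wang's printed
  codimension-2 values, moved to each plane by the sandwich witnesses ALREADY in the tree (orbit `[84]`'s DFS lookup
  table `tab494`, validated by `Top333.tab494_ok`; the orbit values by `Top333.cert_top`); a positional Boolean check in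
  5 `decide` chunks of 51 reads off that entry `k` of `tab494` is the singleton mask of candidate `k` at value `≥ 18`;
* `cert_plane84_any` — the same row for ANY representative: `Cert 3 3 3 [84, g] 18` for every `g < 512` whose form does
  not vanish on `S_[84]` (`reduceB [84] g ≠ 0`), by `cov494` + `cert_congr_last`; so certificates using another system
  of coset representatives (p2's even-parity «evencomp» list) get their relative singleton rows too, and
  `cert494_20_of_noValidSetSub_of_coverBy` / `cert494_20_of_noValidAllSub_of_coverBy` are the end theorems for such a
  list (`coverByB 3 3 red cands`, `hred`);
* `cert494_20_of_noValidAllSub` — `Cert 3 3 3 [84] 20` from «no profile `Fin 19 → c494` is valid against all certified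
  `[84]`-rows» (multiplicity counted; `hN = Top333.cert_codim1_84`, `hcov = Top333.cov494`);
* `cert494_20_of_noValidSetSub` — the 0/1 (set) form: «no 19-subset of `c494` meets every certified `[84]`-row cap»
  (`hsingle = cert_plane84'`, cap `≤ 1` from the planes).

Nothing here proves `Cert 3 3 3 [84] 20`; the `hno` hypothesis is what the p1 lineage's PROFILE-CERT kernel checker at
`S ≠ 0` (lead 01:02:03Z, Sunday task 1) discharges from p2's certificate (`certificates/ROOT-333-F2/p2-pcert/lifts/`).
-/

set_option Elab.async false

namespace Summit.Ventures.MM22.GF2Cert.Top333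

open Summit.MatrixMultiplication.OmegaCensus.GF2RankLB Literature.Computability.AlgebraicComplexity
open Summit.Ventures.MM22.GF2Cert Summit.Ventures.MM22.GF2Cert.Profile

/-- Positional check of entry `k` of orbit `[84]`'s lookup table: its mask is the singleton of candidate `k` and it
points to an orbit certified at `≥ 18`. -/
def planeRowB (k : ℕ) : Bool :=
  (extraOf c494 (tab494.getD k (0, 0, 0, 0, 0, 0)).1 == [c494.getD k 0]) &&
    decide (18 ≤ bnd os (tab494.getD k (0, 0, 0, 0, 0, 0)).2.1)

/-- Positional check, chunk 0 (`[0·51, 0·51 + 51)`; `255 = 5 · 51`). -/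
theorem planeRows_0 : allRange planeRowB (0 * 51) 51 = true := by
  decide +kernel

/-- Positional check, chunk 1. -/
theorem planeRows_1 : allRange planeRowB (1 * 51) 51 = true := by
  decide +kernel

/-- Positional check, chunk 2. -/
theorem planeRows_2 : allRange planeRowB (2 * 51) 51 = true := by
  decide +kernel

/-- Positional check, chunk 3. -/
theorem planeRows_3 : allRange planeRowB (3 * 51) 51 = true := by
  decide +kernel

/-- Positional check, chunk 4. -/
theorem planeRows_4 : allRange planeRowB (4 * 51) 51 = true := by
  decide +kernel

/-- All 255 entries pass the positional check. -/
theorem planeRows_ok : ∀ k < 5 * 51, planeRowB k = true := by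
  refine forall_lt_of_chunks planeRowB 51 5 fun j hj => ?_
  interval_cases j
  · exact planeRows_0
  · exact planeRows_1
  · exact planeRows_2
  · exact planeRows_3
  · exact planeRows_4

/-- Orbit `[84]`'s lookup table has 255 entries. -/
theorem tab494_length : tab494.length = 255 := by
  decide +kernel

/-- Orbit `[84]` has 255 candidate forms. -/
theorem c494_length : c494.length = 255 := by
  decide +kernel

/-- Every entry of orbit `[84]`'s lookup table certifies its row: the sandwich (validated by `tab494_ok`) moves the
cited orbit's certificate (`cert_top`) to the constraint list `[84] ++ extraOf c494 mask`. -/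
theorem cert_of_mem_tab494 {e : ℕ × ℕ × ℕ × ℕ × ℕ × ℕ} (he : e ∈ tab494) :
    Cert 3 3 3 ([84] ++ extraOf c494 e.1) (bnd os e.2.1) := by
  have h := tab494_ok
  rw [tableOK, List.all_eq_true] at h
  have hv := h e he
  simp only [Bool.and_eq_true, decide_eq_true_eq] at hv
  exact fun r β => le_of_sandB hv.2 (cert_top e.2.1 (by rw [os_length]; omega)) r β

/-- **Every plane through form `84` is a certified row at `18`**, indexed by the candidate list: for `k < 255`,
`Cert 3 3 3 [84, c494[k]] 18` (Wang 2026's codimension-2 orbit values, transported by orbit `[84]`'s table). -/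
theorem cert_plane84_idx (k : ℕ) (hk : k < 255) : Cert 3 3 3 [84, c494.getD k 0] 18 := by
  have hrow := planeRows_ok k (by omega)
  simp only [planeRowB, Bool.and_eq_true, beq_iff_eq, decide_eq_true_eq] at hrow
  obtain ⟨hex, hb⟩ := hrow
  have hlt : k < tab494.length := by rw [tab494_length]; exact hk
  have hmem : tab494.getD k (0, 0, 0, 0, 0, 0) ∈ tab494 := by
    rw [List.getD_eq_getElem _ _ hlt]
    exact List.getElem_mem hlt
  have hc := cert_of_mem_tab494 hmem
  rw [hex] at hc
  exact cert_mono hb hc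

/-- **Every plane through form `84` is a certified row at `18`**, by membership in the candidate list `c494`. -/
theorem cert_plane84 (f : ℕ) (hf : f ∈ c494) : Cert 3 3 3 [84, f] 18 := by
  obtain ⟨k, hk, rfl⟩ := List.getElem_of_mem hf
  have h := cert_plane84_idx k (by rw [c494_length] at hk; exact hk)
  rwa [List.getD_eq_getElem _ _ hk] at h

/-- The same in the shape of the `hsingle` hypothesis of `cert_succ_of_noValidSetSub` (`K ++ [f]`, bound `N − 1`). -/
theorem cert_plane84' (f : ℕ) (hf : f ∈ c494) : Cert 3 3 3 ([84] ++ [f]) (19 - 1) :=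
  cert_plane84 f hf

/-- **`494 @ 20` from «no valid 19-profile on `S_[84]`»** (multiplicity counted): if no profile `Fin 19 → c494` is
valid against all certified `[84]`-rows, then `Cert 3 3 3 [84] 20`. -/
theorem cert494_20_of_noValidAllSub
    (hno : ∀ prof : Fin 19 → ℕ, (∀ i, prof i ∈ c494) → ValidAllSub 3 3 3 [84] 19 prof → False) :
    Cert 3 3 3 [84] 20 :=
  cert_succ_of_noValidAllSub cert_codim1_84 c494 cov494 hno

/-- **`494 @ 20` from «no valid 0/1 19-profile on `S_[84]`»** (set form; the planes give cap `≤ 1`): if no 19-subset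
`M ⊆ c494` satisfies `b + #(M ∩ L) ≤ 19` for every certified `[84]`-row `(L, b)`, then `Cert 3 3 3 [84] 20`. -/
theorem cert494_20_of_noValidSetSub
    (hno : ∀ M : Finset ℕ, M.card = 19 → (∀ f ∈ M, f ∈ c494) →
      (∀ (L : List ℕ) (b : ℕ), Cert 3 3 3 ([84] ++ L) b → b + (M.filter fun f => f ∈ L).card ≤ 19) → False) :
    Cert 3 3 3 [84] 20 :=
  cert_succ_of_noValidSetSub cert_codim1_84 c494 cov494 cert_plane84' hno

/-- **With explicit rows** (for checkers citing a finite row list): `Cert [84] 19`-many products, certified rows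
`Cert 3 3 3 ([84] ++ M) b`, and «no profile `Fin 19 → c494` valid against the cited rows» give `Cert 3 3 3 [84] 20`. -/
theorem cert494_20_of_noProfileSub (rows : List (List ℕ × ℕ)) (hrows : ∀ r ∈ rows, Cert 3 3 3 ([84] ++ r.1) r.2)
    (hno : ∀ prof : Fin 19 → ℕ, (∀ i, prof i ∈ c494) → RowsOK 19 rows prof → False) :
    Cert 3 3 3 [84] 20 :=
  cert_succ_of_noProfile_sub cert_codim1_84 rows hrows c494 cov494 hno

/-! ## Any system of representatives -/

/-- **Every plane through form `84` is a certified row at `18`, for ANY representative pattern**: if `g < 2^9` does not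
reduce to `0` modulo `84` (i.e. its form does not vanish on `S_[84]`), then `Cert 3 3 3 [84, g] 18`. -/
theorem cert_plane84_any (g : ℕ) (hg : g < 2 ^ (3 * 3)) (h0 : reduceB [84] g ≠ 0) : Cert 3 3 3 [84, g] 18 := by
  have hc := cov494
  rw [coverB, allLT_iff] at hc
  have hr := hc g hg
  simp only [Bool.or_eq_true, beq_iff_eq] at hr
  rcases hr with hr | hr
  · exact absurd hr h0
  · rw [List.contains_iff_mem] at hr
    exact cert_congr_last (K := [84]) (fun u hu => (form_reduceB_eq [84] g u hu).symm) (cert_plane84 _ hr)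

/-- Executable side condition on a candidate list: every member is a pattern `< 2^9` not reducing to `0` modulo `84`. -/
def cands84OKB (cands : List ℕ) : Bool :=
  cands.all fun f => decide (f < 2 ^ (3 * 3)) && !(reduceB [84] f == 0)

/-- Relative singleton rows for every member of a checked candidate list. -/
theorem cert_plane84_of_cands84OKB {cands : List ℕ} (h : cands84OKB cands = true) :
    ∀ f ∈ cands, Cert 3 3 3 ([84] ++ [f]) (19 - 1) := by
  intro f hf
  rw [cands84OKB, List.all_eq_true] at h
  have h1 := h f hf
  simp only [Bool.and_eq_true, decide_eq_true_eq, Bool.not_eq_true', beq_eq_false_iff_ne, ne_eq] at h1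
  exact cert_plane84_any f h1.1 h1.2

/-- **`494 @ 20`, set form, for ANY covering system of representatives** (e.g. p2's even-parity list): a representative
map `red` agreeing with the identity on `S_[84]`, a candidate list it covers (`coverByB`), all of whose members are
genuine representatives (`cands84OKB`), and «no valid 19-subset» give `Cert 3 3 3 [84] 20`. -/
theorem cert494_20_of_noValidSetSub_of_coverBy {red : ℕ → ℕ}
    (hred : ∀ g, ∀ u ∈ subOf 3 3 [84], form 3 3 (red g) u = form 3 3 g u) (cands : List ℕ)
    (hcov : coverByB 3 3 red cands = true) (hc : cands84OKB cands = true)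
    (hno : ∀ M : Finset ℕ, M.card = 19 → (∀ f ∈ M, f ∈ cands) →
      (∀ (L : List ℕ) (b : ℕ), Cert 3 3 3 ([84] ++ L) b → b + (M.filter fun f => f ∈ L).card ≤ 19) → False) :
    Cert 3 3 3 [84] 20 :=
  cert_succ_of_noValidSetSub_of_coverBy cert_codim1_84 hred cands hcov (cert_plane84_of_cands84OKB hc) hno

/-- **`494 @ 20`, multiplicity form, for ANY covering system of representatives.** -/
theorem cert494_20_of_noValidAllSub_of_coverBy {red : ℕ → ℕ}
    (hred : ∀ g, ∀ u ∈ subOf 3 3 [84], form 3 3 (red g) u = form 3 3 g u) (cands : List ℕ)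
    (hcov : coverByB 3 3 red cands = true)
    (hno : ∀ prof : Fin 19 → ℕ, (∀ i, prof i ∈ cands) → ValidAllSub 3 3 3 [84] 19 prof → False) :
    Cert 3 3 3 [84] 20 :=
  cert_succ_of_noValidAllSub_of_coverBy cert_codim1_84 hred cands hcov hno

end Summit.Ventures.MM22.GF2Cert.Top333
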